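import Summits.RiemannHypothesis.RiemannHypothesis.Theorems.CCRouteAdapters
import Literature.NumberTheory.ConnesConsani2021.ProlateEigenvaluePolynomialDecay
import Literature.NumberTheory.ConnesConsani2021.TraceRemainderEpsilon
import Literature.NumberTheory.ConnesConsani2021.SpectralCertificate
import HarnessLib

/-!
# Route «ConnesConsaniSemilocal», crux K2 `DensitySlope` (stmt-RiemannHypothesis-19308) — closer MODULO (E-b) ONLY

RH-FREE bookkeeping of an RH-free corpus statement (cell `rh-crit/cc`, seat `rh-crit-cc-iso` g4; chain of record
cc-lead R78/R88 (1)(iv)(v), t7 g2 08:54:18Z (ii), BOUNDARY LEDGER v3 → «K2 ⇐ {(E-b)}»).  K2 says: for every `C²`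
extension `G` of the archimedean density, `G′(0) = ε′(1₊)` is real with `22.9 ≤ ε′(1₊) ≤ 23.1` (Connes–Consani
2021 Lemma 5.4, printed value `22.9965`).  The ANALYTIC half — `G′(0) = Σ_n t(n)`, `t(n) = 2λ(n)²(1−λ(n)²)⁻¹ξ_n(1)²`
summable — is Lemma 5.4, now a tree THEOREM with no literature input (`CC2021_lemma_5_4_holds`, t7 g2
`ProlateEigenvaluePolynomialDecay.lean` p433298, via gm-t16 E9/E10 and the unconditional decay
`summable_abs_prolateEigen_mul_sq`); the NUMERICAL half is the enclosure (E-b) `22.9 ≤ Σ_n t(n) ≤ 23.1` for the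
prolate family, which is being certified in-kernel (t15 g2 / eng-1 / gm-t16 Tier 1–2, target theorem
`epsSlope_enclosure_holds` of `EpsSlopeEnclosure.lean`) and is, until then, the second conjunct of t7's named
fact `CC2021_section6_enclosures` (NUMERICAL-CERTIFIED-EXTERNAL).  Hence: `densitySlope_of_epsSlopeEnclosure`
takes (E-b) VERBATIM as its only hypothesis (the unconditional closer is ONE application of it to
`epsSlope_enclosure_holds` the hour that lands), and `densitySlope_of_section6` is the interim form over the
named fact (supersedes the Osipov-binder draft of R78: no `Osipov2013_thm_33` any more).  `conditional-result`s for
the gate; neither closes the item.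
WHAT THIS IS NOT: any claim about RH — K2 is an RH-FREE binder of a route whose leaf (CC2021 eq. (4)) is RH-FREE
and not RH-detecting; the RH-EQUIVALENT residual `IsolatedCC` is untouched.  Nothing here bears on the truth of RH.
-/

-- `Summit.RiemannHypothesis.RiemannHypothesis.…` duplicates `RiemannHypothesis` BY DESIGN (D-0017).
set_option linter.dupNamespace false

noncomputable section

namespace Summit.RiemannHypothesis.RiemannHypothesis.Theorems.CCRouteAdapters

open Literature.NumberTheory.LFunctions Literature.NumberTheory.ConnesConsani2021

/-- RH-FREE. **K2 `DensitySlope` from the slope enclosure (E-b) ALONE** (route «ConnesConsaniSemilocal», item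
stmt-RiemannHypothesis-19308): Lemma 5.4 is the tree theorem `CC2021_lemma_5_4_holds` (t7 g2), so t5's bridge
`densitySlope_of_lemma_5_4` needs only the enclosure `22.9 ≤ Σ_n t(n) ≤ 23.1` for the even prolate family — the
statement t15's in-kernel certificate `epsSlope_enclosure_holds` will prove VERBATIM; then the K2 transport
`densitySlope_iff`.  [cite: ConnesConsani2021, Lemma 5.4 §5 p. 20 (= arXiv Lemma 31); App. G (numerical values)] -/
theorem densitySlope_of_epsSlopeEnclosure
    (hEb : ∀ ψ : ℕ → ℝ → ℝ, (∀ n, IsProlateFunction 1 (2 * n) (ψ n)) →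
      (22.9 : ℝ) ≤ ∑' n, epsSlopeTerm (ψ n) ∧ ∑' n, epsSlopeTerm (ψ n) ≤ 23.1) :
    Summit.RiemannHypothesis.RiemannHypothesis.Theses.ConnesConsaniSemilocal.DensitySlope :=
  densitySlope_iff.mpr (densitySlope_of_lemma_5_4 CC2021_lemma_5_4_holds hEb)

/-- RH-FREE. **K2 `DensitySlope`, INTERIM form modulo t7's named fact `CC2021_section6_enclosures`** (its second
conjunct is (E-b); the first, (E-a), is not used) — no Osipov binder (supersedes cc-lead R78's
`densitySlope_of_osipov_of_section6`). [cite: ConnesConsani2021, Lemma 5.4 §5 p. 20 (= arXiv Lemma 31); §6 (printed enclosures)] -/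
theorem densitySlope_of_section6 (h6 : CC2021_section6_enclosures) :
    Summit.RiemannHypothesis.RiemannHypothesis.Theses.ConnesConsaniSemilocal.DensitySlope :=
  densitySlope_of_epsSlopeEnclosure h6.2

end Summit.RiemannHypothesis.RiemannHypothesis.Theorems.CCRouteAdapters

end
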